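import Literature.Algebra.Module.SocleSeriesFunctorial
import Literature.Algebra.Module.LoewySeriesLattice
import Mathlib.LinearAlgebra.Isomorphisms
import HarnessLib

/-!
# Iterating the Loewy series: `soc^{i+j} M / socⁱ M = socʲ(M/socⁱ M)`, `rad^{i+j} M = radʲ(radⁱ M)`, and `radⁱ M ≤ socʲ M ⟺ rad^{i+j} M = 0`
# (Krause, Conventions «Socle», «Radical»; Anderson–Fuller §32)

Family `hodge`, lane `lit-hodgefound` (foundations library; seat `lit-hodgefound-p39`, generation 34, row g34-#9); topic `Algebra/Module`,
namespace `Literature.Algebra.Module.SocleRadical` (continued).  Sequel of `LoewySeries` (g33-#14: `socleSeries`, `radicalSeries`,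
`radicalSeries_le_socleSeries_of_eq_bot`, `loewyLength`), `LoewySeriesLattice` (g34-#1: the lattice recursions `socⁿ⁺¹ = socⁿ ⊔ ⋁ covers`,
`radⁿ⁺¹ = radⁿ ⊓ ⋀ co-covers`) and `SocleSeriesFunctorial` (g34-#4: `g⁻¹(socⁿ M) = socⁿ P`, `radⁿ M = 0 ⟹ radⁿ P = 0` along injections) over an
ARBITRARY ring `R`.  Krause's definitions «`socⁿ⁺¹(X)/socⁿ(X) = soc(X/socⁿ(X))`» and «`radⁿ⁺¹(X) = rad(radⁿ X)`» iterate to the SEMIGROUP laws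
**`soc^{i+j} M = π⁻¹ socʲ(M/socⁱ M)`** and **`rad^{i+j} M = radʲ(radⁱ M)`** (Anderson–Fuller §32 writes the series as `r_M(J^{i+j})` and `J^{i+j} M`,
where this is plain); they are proved here from two transport lemmas (the socle pulled back along a SURJECTION, the radical pushed along an
INJECTION, both in the lattice form of g34-#1).  Consequences: **`radⁱ M ≤ socʲ M ⟺ rad^{i+j} M = 0`** (⟸ for Artinian `M` is g33-#14), hence for
`M` of finite length **`ℓℓ(M) ≤ i + j ⟺ radⁱ M ≤ socʲ M`**, in particular `ℓℓ(M) ≤ 2 ⟺ rad M ≤ soc M`, `ℓℓ(M) ≤ n+1 ⟺ radⁿ M` is semisimple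
`⟺ M/socⁿ M` is semisimple; and the lengths of the truncated series, `ℓℓ(radⁱ M) = ℓℓ(M) − i`, `ht(M/socⁱ M) = ht(M) − i`.
Theorems only (one private arithmetic helper), 0 `sorry`, no definition, no named fact (net debt 0, D-0026), no instance, no notation.

## What is formalised (any ring `R`)

* §1 transport: **`comap_socle_eq_of_surjective`** (`g⁻¹ soc(Q) = ker g ⊔ ⋁{N | ker g ⋖ N}` for `g : M ↠ Q`), **`map_jacobson_eq_of_injective`**
  (`f(rad P) = f(P) ⊓ ⋀{N | N ⋖ f(P)}` for `f : P ↪ M`).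
* §2 semigroup laws: **`socleSeries_add : soc^{i+j} M = π⁻¹ socʲ(M/socⁱ M)`**, **`radicalSeries_add : rad^{i+j} M = radʲ(radⁱ M)`**, and the
  «other» recursions `socleSeries_succ' : socⁿ⁺¹ M = π⁻¹ socⁿ(M/soc M)`, `radicalSeries_succ' : radⁿ⁺¹ M = radⁿ(rad M)`.
* §3 **`radicalSeries_le_socleSeries_iff : radⁱ M ≤ socʲ M ⟺ rad^{i+j} M = 0`** (Artinian; ⟹ for every module:
  `radicalSeries_add_eq_bot_of_le`), `socleSeries_submodule_socleSeries` (`socʲ(socʲ M) = socʲ M`), `radicalSeries_socleSeries_eq_bot`.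
* §4 finite length: **`loewyLength_le_add_iff : ℓℓ(M) ≤ i + j ⟺ radⁱ M ≤ socʲ M`**, `loewyLength_le_two_iff`, `loewyLength_le_succ_iff_isSemisimpleModule_radicalSeries`,
  `loewyLength_le_succ_iff_isSemisimpleModule_quotient_socleSeries`, **`loewyLength_radicalSeries : ℓℓ(radⁱ M) = ℓℓ(M) − i`**,
  **`socleLength_quotient_socleSeries : ht(M/socⁱ M) = ht(M) − i`**.

## Mathlib / Literature search

Mathlib: `LinearMap.quotKerEquivOfSurjective(_apply_mk)`, `LinearEquiv.ofInjective(_apply)`, `Submodule.comap_equiv_eq_map_symm`,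
`Module.map_jacobson_of_ker_le`, `Submodule.map_comp`, `Submodule.comap_comp`, `Submodule.map_subtype_top`, `Submodule.comap_subtype_self`,
`IsArtinian.isSemisimpleModule_iff_jacobson`; Literature: g33-#4 `map_socle`, `socle_eq_top_iff`; g33-#14 `socleSeries_succ`, `radicalSeries_succ`,
`radicalSeries_le_socleSeries_of_eq_bot`, `radicalSeries_eq_bot_of_socleSeries_eq_top`, `radicalSeries_eq_bot_iff_loewyLength_le`,
`socleSeries_eq_top_iff_socleLength_le`, `radicalSeries_eq_bot_iff`, `map_mkQ_socleSeries_succ`; g34-#1 `comap_mkQ_socle_eq`, `map_subtype_jacobson_eq`,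
`socleSeries_succ_eq_sup_sSup`, `radicalSeries_succ_eq_inf_sInf`; g34-#4 `comap_subtype_socleSeries`, `radicalSeries_eq_bot_of_injective`.
`rg -n 'socleSeries_add|radicalSeries_add|loewyLength_le_add'` over `Literature` → nothing before this file.

## References

* H. Krause, *Homological Theory of Representations*, CUP (2021), Conventions and Notations (p. xxiv «Socle», «Radical»); §11.2 (p. 360). [Krause2021]
* F. W. Anderson, K. R. Fuller, *Rings and Categories of Modules*, 2nd ed., GTM 13 (1992), §32 (p. 346: Loewy length, `J^k M`, `r_M(J^k)`).
  [AndersonFuller1992]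
* A. J. Berrick, M. E. Keating, *An Introduction to Rings and Modules* (2000), §4.1.13, Cor. 4.1.18. [BerrickKeating2000]
-/

open Submodule

namespace Literature.Algebra.Module

namespace SocleRadical

variable {R : Type*} [Ring R] {M : Type*} [AddCommGroup M] [Module R M]
  {P : Type*} [AddCommGroup P] [Module R P] {Q : Type*} [AddCommGroup Q] [Module R Q]

/-! ## §1 Transport: the socle pulled back along a surjection, the radical pushed along an injection -/

/-- **`g⁻¹(soc Q) = ker g ⊔ ⋁{N | ker g ⋖ N}` for a SURJECTION `g : M ↠ Q`** (`Q ≅ M/ker g`, the socle is transported by isomorphisms, g33-#4,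
and `π⁻¹ soc(M/K) = K ⊔ ⋁ covers`, g34-#1). [cite: Krause2021, Conventions «Socle»] [cite: AndersonFuller1992, §9 Prop. 9.7] -/
theorem comap_socle_eq_of_surjective (g : M →ₗ[R] Q) (hg : Function.Surjective g) :
    (socle R Q).comap g = LinearMap.ker g ⊔ sSup {N : Submodule R M | LinearMap.ker g ⋖ N} := by
  set e := g.quotKerEquivOfSurjective hg
  have hcomp : g = (e : M ⧸ LinearMap.ker g →ₗ[R] Q) ∘ₗ (LinearMap.ker g).mkQ := by
    ext x
    simp [e, LinearMap.quotKerEquivOfSurjective_apply_mk]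
  conv_lhs => rw [hcomp]
  rw [Submodule.comap_comp, Submodule.comap_equiv_eq_map_symm, map_socle e.symm]
  exact comap_mkQ_socle_eq _

/-- **`f(rad P) = f(P) ⊓ ⋀{N | N ⋖ f(P)}` for an INJECTION `f : P ↪ M`** (`P ≅ f(P)`, the radical is transported by isomorphisms, and
`rad K = K ⊓ ⋀ co-covers` inside `Sub(M)`, g34-#1). [cite: Krause2021, Conventions «Radical»] [cite: AndersonFuller1992, §9 Prop. 9.13] -/
theorem map_jacobson_eq_of_injective (f : P →ₗ[R] M) (hf : Function.Injective f) :
    (Module.jacobson R P).map f = LinearMap.range f ⊓ sInf {N : Submodule R M | N ⋖ LinearMap.range f} := by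
  set e := LinearEquiv.ofInjective f hf
  have hcomp : f = (LinearMap.range f).subtype ∘ₗ (e : P →ₗ[R] ↥(LinearMap.range f)) := by
    ext x
    simp [e]
  have hJ : (Module.jacobson R P).map (e : P →ₗ[R] ↥(LinearMap.range f)) = Module.jacobson R ↥(LinearMap.range f) :=
    Module.map_jacobson_of_ker_le (f := (e : P →ₗ[R] ↥(LinearMap.range f))) e.surjective
      (by rw [LinearEquiv.ker]; exact bot_le)
  conv_lhs => rw [hcomp]
  rw [Submodule.map_comp, hJ]
  exact map_subtype_jacobson_eq _

/-! ## §2 The semigroup laws `soc^{i+j} M = π⁻¹ socʲ(M/socⁱ M)`, `rad^{i+j} M = radʲ(radⁱ M)` -/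

variable (R M) in
/-- **`soc^{i+j} M = π⁻¹ socʲ(M/socⁱ M)`** (`π : M → M/socⁱ M`): Krause's recursion «`socⁿ⁺¹(X)/socⁿ(X) = soc(X/socⁿ(X))`» iterated `j` times.
[cite: Krause2021, Conventions «Socle»] [cite: AndersonFuller1992, §32 (p. 346)] -/
theorem socleSeries_add (i j : ℕ) :
    socleSeries R M (i + j) = (socleSeries R (M ⧸ socleSeries R M i) j).comap (socleSeries R M i).mkQ := by
  induction j with
  | zero => rw [Nat.add_zero, socleSeries_zero, Submodule.comap_bot, Submodule.ker_mkQ]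
  | succ j ih =>
    -- the composite surjection `M → M/socⁱ M → (M/socⁱ M)/socʲ(M/socⁱ M)` has kernel `soc^{i+j} M`
    set K := socleSeries R M i
    set g : M →ₗ[R] (M ⧸ K) ⧸ socleSeries R (M ⧸ K) j := (socleSeries R (M ⧸ K) j).mkQ ∘ₗ K.mkQ with hg
    have hgs : Function.Surjective g := (Submodule.mkQ_surjective _).comp (Submodule.mkQ_surjective _)
    have hker : LinearMap.ker g = socleSeries R M (i + j) := by
      rw [hg, LinearMap.ker_comp, Submodule.ker_mkQ, ih]
    rw [← Nat.add_assoc, socleSeries_succ_eq_sup_sSup R M (i + j), socleSeries_succ R (M ⧸ K) j,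
      ← Submodule.comap_comp K.mkQ (socleSeries R (M ⧸ K) j).mkQ, ← hg, comap_socle_eq_of_surjective g hgs, hker]

variable (R M) in
/-- **`rad^{i+j} M = radʲ(radⁱ M)`** (read in `Sub(M)`): Krause's recursion «`radⁿ⁺¹(X) = rad(radⁿ X)`» iterated `j` times.
[cite: Krause2021, Conventions «Radical»] [cite: AndersonFuller1992, §32 (p. 346)] -/
theorem radicalSeries_add (i j : ℕ) :
    radicalSeries R M (i + j) = (radicalSeries R ↥(radicalSeries R M i) j).map (radicalSeries R M i).subtype := by
  induction j with
  | zero => rw [Nat.add_zero, radicalSeries_zero, Submodule.map_subtype_top]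
  | succ j ih =>
    -- the composite injection `radʲ(radⁱ M) ↪ radⁱ M ↪ M` has range `rad^{i+j} M`
    set K := radicalSeries R M i
    set f : ↥(radicalSeries R ↥K j) →ₗ[R] M := K.subtype ∘ₗ (radicalSeries R ↥K j).subtype with hf
    have hfi : Function.Injective f := (Submodule.injective_subtype _).comp (Submodule.injective_subtype _)
    have hrange : LinearMap.range f = radicalSeries R M (i + j) := by
      rw [hf, LinearMap.range_comp, Submodule.range_subtype, ih]
    rw [← Nat.add_assoc, radicalSeries_succ_eq_inf_sInf R M (i + j), radicalSeries_succ R (↥K) j,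
      ← Submodule.map_comp (radicalSeries R (↥K) j).subtype K.subtype, ← hf, map_jacobson_eq_of_injective f hfi, hrange]

variable (R M) in
/-- The «other» recursion for the socle series: `socⁿ⁺¹ M = π⁻¹ socⁿ(M/soc M)`. [cite: Krause2021, Conventions «Socle»] -/
theorem socleSeries_succ' (n : ℕ) :
    socleSeries R M (n + 1) = (socleSeries R (M ⧸ socle R M) n).comap (socle R M).mkQ := by
  rw [Nat.add_comm, socleSeries_add, socleSeries_one]

variable (R M) in
/-- The «other» recursion for the radical series: `radⁿ⁺¹ M = radⁿ(rad M)`. [cite: Krause2021, Conventions «Radical»] -/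
theorem radicalSeries_succ' (n : ℕ) :
    radicalSeries R M (n + 1) = (radicalSeries R ↥(Module.jacobson R M) n).map (Module.jacobson R M).subtype := by
  rw [Nat.add_comm, radicalSeries_add, radicalSeries_one]

/-! ## §3 `radⁱ M ≤ socʲ M ⟺ rad^{i+j} M = 0` -/

/-- `socʲ(socʲ M) = socʲ M`: the submodule `socʲ M` is exhausted by its own socle series in `j` steps (g34-#4: `socʲ K = K ∩ socʲ M`).
[cite: Krause2021, Conventions «Socle»] [cite: AndersonFuller1992, §9 Cor. 9.9] -/
theorem socleSeries_submodule_socleSeries (j : ℕ) : socleSeries R ↥(socleSeries R M j) j = ⊤ := by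
  rw [← comap_subtype_socleSeries, Submodule.comap_subtype_self]

/-- Hence `radʲ(socʲ M) = 0`. [cite: Krause2021, Conventions «Socle», «Radical»] -/
theorem radicalSeries_socleSeries_eq_bot (j : ℕ) : radicalSeries R ↥(socleSeries R M j) j = ⊥ :=
  radicalSeries_eq_bot_of_socleSeries_eq_top (socleSeries_submodule_socleSeries j)

/-- **`radⁱ M ≤ socʲ M ⟹ rad^{i+j} M = 0`** for EVERY module: `rad^{i+j} M = radʲ(radⁱ M)` and `radⁱ M ↪ socʲ M` with `radʲ(socʲ M) = 0` (g34-#4: `radʲ`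
vanishes on submodules when it vanishes on the module). [cite: Krause2021, Conventions «Socle», «Radical»] [cite: AndersonFuller1992, §32 (p. 346)] -/
theorem radicalSeries_add_eq_bot_of_le {i j : ℕ} (h : radicalSeries R M i ≤ socleSeries R M j) : radicalSeries R M (i + j) = ⊥ := by
  rw [radicalSeries_add, radicalSeries_eq_bot_of_injective (Submodule.inclusion h) (Submodule.inclusion_injective h)
    (radicalSeries_socleSeries_eq_bot j), Submodule.map_bot]

/-- **`radⁱ M ≤ socʲ M ⟺ rad^{i+j} M = 0` for an Artinian module** (⟸ is g33-#14 `radicalSeries_le_socleSeries_of_eq_bot`).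
[cite: Krause2021, Conventions «Socle», «Radical»] [cite: AndersonFuller1992, §32 (p. 346)] -/
theorem radicalSeries_le_socleSeries_iff [IsArtinian R M] {i j : ℕ} :
    radicalSeries R M i ≤ socleSeries R M j ↔ radicalSeries R M (i + j) = ⊥ := by
  refine ⟨radicalSeries_add_eq_bot_of_le, fun h => ?_⟩
  have h1 := radicalSeries_le_socleSeries_of_eq_bot h j (Nat.le_add_left j i)
  rwa [Nat.add_sub_cancel] at h1

/-! ## §4 Modules of finite length: `ℓℓ(M) ≤ i + j ⟺ radⁱ M ≤ socʲ M`; `ℓℓ(radⁱ M) = ℓℓ(M) − i`, `ht(M/socⁱ M) = ht(M) − i` -/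

/-- **`ℓℓ(M) ≤ i + j ⟺ radⁱ M ≤ socʲ M`** for `M` of finite length. [cite: Krause2021, Conventions «Socle», «Radical»; §11.2 (p. 360)]
[cite: AndersonFuller1992, §32 (p. 346)] -/
theorem loewyLength_le_add_iff [IsArtinian R M] [IsNoetherian R M] {i j : ℕ} :
    loewyLength R M ≤ i + j ↔ radicalSeries R M i ≤ socleSeries R M j := by
  rw [← radicalSeries_eq_bot_iff_loewyLength_le, radicalSeries_le_socleSeries_iff]

/-- **`ℓℓ(M) ≤ 2 ⟺ rad M ≤ soc M`** (finite length). [cite: Krause2021, Conventions «Socle», «Radical»] [cite: AndersonFuller1992, §32 (p. 346)] -/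
theorem loewyLength_le_two_iff [IsArtinian R M] [IsNoetherian R M] : loewyLength R M ≤ 2 ↔ Module.jacobson R M ≤ socle R M := by
  rw [show (2 : ℕ) = 1 + 1 from rfl, loewyLength_le_add_iff, radicalSeries_one, socleSeries_one]

/-- `ℓℓ(M) ≤ n + 1 ⟺ radⁿ M` is semisimple (finite length; `radⁿ⁺¹ M = rad(radⁿ M) = 0` iff the Artinian `radⁿ M` is semisimple).
[cite: Krause2021, Conventions «Radical»] [cite: BerrickKeating2000, Cor. 4.1.18] -/
theorem loewyLength_le_succ_iff_isSemisimpleModule_radicalSeries [IsArtinian R M] [IsNoetherian R M] (n : ℕ) :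
    loewyLength R M ≤ n + 1 ↔ IsSemisimpleModule R ↥(radicalSeries R M n) := by
  rw [← radicalSeries_eq_bot_iff_loewyLength_le, radicalSeries_succ,
    (Submodule.map_injective_of_injective (Submodule.injective_subtype _)).eq_iff' (Submodule.map_bot _),
    IsArtinian.isSemisimpleModule_iff_jacobson]

/-- `ℓℓ(M) ≤ n + 1 ⟺ M/socⁿ M` is semisimple (finite length; `socⁿ⁺¹ M = M` iff `soc(M/socⁿ M) = M/socⁿ M`). [cite: Krause2021, Conventions «Socle»]
[cite: BerrickKeating2000, §4.1.13] -/
theorem loewyLength_le_succ_iff_isSemisimpleModule_quotient_socleSeries [IsArtinian R M] [IsNoetherian R M] (n : ℕ) :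
    loewyLength R M ≤ n + 1 ↔ IsSemisimpleModule R (M ⧸ socleSeries R M n) := by
  rw [← radicalSeries_eq_bot_iff_loewyLength_le, radicalSeries_eq_bot_iff, socleSeries_succ, ← LinearMap.range_le_iff_comap,
    Submodule.range_mkQ, top_le_iff, socle_eq_top_iff]

/-- Arithmetic plumbing: `inf {j | a ≤ i + j} = a − i`. [folklore] -/
private theorem sInf_setOf_le_add (a i : ℕ) : sInf {j : ℕ | a ≤ i + j} = a - i := by
  apply le_antisymm
  · exact Nat.sInf_le (Set.mem_setOf.mpr (by omega))
  · have hmem : sInf {j : ℕ | a ≤ i + j} ∈ {j : ℕ | a ≤ i + j} := Nat.sInf_mem ⟨a, Set.mem_setOf.mpr (by omega)⟩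
    rw [Set.mem_setOf_eq] at hmem
    omega

variable (R M) in
/-- **`ℓℓ(radⁱ M) = ℓℓ(M) − i`** for `M` of finite length (`radʲ(radⁱ M) = 0 ⟺ rad^{i+j} M = 0`). [cite: Krause2021, Conventions «Radical»; §11.2 (p. 360)]
[cite: AndersonFuller1992, §32 (p. 346)] -/
theorem loewyLength_radicalSeries [IsArtinian R M] [IsNoetherian R M] (i : ℕ) :
    loewyLength R ↥(radicalSeries R M i) = loewyLength R M - i := by
  have hS : {j | radicalSeries R ↥(radicalSeries R M i) j = ⊥} = {j | loewyLength R M ≤ i + j} := by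
    ext j
    rw [Set.mem_setOf_eq, Set.mem_setOf_eq, ← radicalSeries_eq_bot_iff_loewyLength_le, radicalSeries_add,
      (Submodule.map_injective_of_injective (Submodule.injective_subtype _)).eq_iff' (Submodule.map_bot _)]
  rw [loewyLength_def, hS, sInf_setOf_le_add]

variable (R M) in
/-- **`ht(M/socⁱ M) = ht(M) − i`** for `M` of finite length (`socʲ(M/socⁱ M) = M/socⁱ M ⟺ soc^{i+j} M = M`). [cite: Krause2021, Conventions «Socle»; §11.2 (p. 360)]
[cite: AndersonFuller1992, §32 (p. 346)] -/
theorem socleLength_quotient_socleSeries [IsArtinian R M] [IsNoetherian R M] (i : ℕ) :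
    socleLength R (M ⧸ socleSeries R M i) = socleLength R M - i := by
  have hS : {j | socleSeries R (M ⧸ socleSeries R M i) j = ⊤} = {j | socleLength R M ≤ i + j} := by
    ext j
    rw [Set.mem_setOf_eq, Set.mem_setOf_eq, ← socleSeries_eq_top_iff_socleLength_le, socleSeries_add,
      ← LinearMap.range_le_iff_comap, Submodule.range_mkQ, top_le_iff]
  rw [socleLength_def, hS, sInf_setOf_le_add]

end SocleRadical

end Literature.Algebra.Module
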